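import Summits.Schanuel.Schanuel.Theorems.DiophantineDichotomyDefs

/-!
# Sketch (crux-ideate r2, ideator 6) — crux `EPiSimultaneousType` (stmt-Schanuel-6118)
# Idea `bounded-index-core`: the entanglement INDEX of a challenger, the core the race actually meets,
# and what closes it.

First-lemma signatures only (elaboration check; `sorry` bodies). Vocabulary of the parent crux's
landed definitions module `Theorems/DiophantineDichotomyDefs.lean` is reused
(`PrimitiveApproxMeasure`, `CodimOneMeasure`, `CodimOneTransfer`, `SiegelInIdeal`, `mvNatHeight`).
-/

noncomputable section

set_option linter.dupNamespace false
set_option linter.unusedVariables false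

namespace Summit.Schanuel.Schanuel.Cruxes.EPiSimultaneousType.BoundedIndexCore

open Summit.Schanuel.Schanuel.Theses.DiophantineDichotomy
open Summit.Schanuel.Schanuel.Cruxes.KhovanskiiApproxType.LwSmallHeight

/-- `θ = (π, e)` exactly as written in the crux. -/
def theta : Fin 2 → ℂ := ![(Real.pi : ℂ), (Real.exp 1 : ℂ)]

/-- The admissibility clause of the crux at level `(d, H)`. -/
def Admissible (d H : ℕ) (γ : Fin 2 → ℂ) : Prop :=
  Module.finrank ℚ ↥(IntermediateField.adjoin ℚ (Set.range γ)) ≤ d ∧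
    ∀ i, ∃ P : Polynomial ℤ, P ≠ 0 ∧ P.natDegree ≤ d ∧ (∀ k, |P.coeff k| ≤ (H : ℤ)) ∧
      Polynomial.aeval (γ i) P = 0

/-- The crux's lower bound `exp(−C(dᵃ log H + dᵇ))`. -/
def bound (a b C : ℝ) (d H : ℕ) : ℝ :=
  Real.exp (-(C * ((d : ℝ) ^ a * Real.log H + (d : ℝ) ^ b)))

/-- Field degree `r = [ℚ(γ₁, γ₂) : ℚ]` of the challenger (0 if transcendental). -/
def fieldDeg (γ : Fin 2 → ℂ) : ℕ := Module.finrank ℚ ↥(IntermediateField.adjoin ℚ (Set.range γ))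

/-- Coordinate degree `dᵢ = [ℚ(γᵢ) : ℚ]`. -/
def coordDeg (γ : Fin 2 → ℂ) (i : Fin 2) : ℕ :=
  Module.finrank ℚ ↥(IntermediateField.adjoin ℚ ({γ i} : Set ℂ))

/-- ENTANGLEMENT INDEX `≤ M`: EACH coordinate generates `ℚ(γ)` up to index `≤ M`,
i.e. `[ℚ(γ) : ℚ(γᵢ)] ≤ M` for `i = 0, 1` (tower law: `r = dᵢ · [ℚ(γ):ℚ(γᵢ)]`). -/
def IndexLE (M : ℕ) (γ : Fin 2 → ℂ) : Prop := ∀ i, fieldDeg γ ≤ M * coordDeg γ i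

/-- `Core M` — the crux RESTRICTED to challengers of entanglement index `≤ M` (the population that the
`n = 2` race actually produces, see `indexLE_of_onCurve` / `epiRace_core`). -/
def Core (M : ℕ) : Prop :=
  ∃ a b C : ℝ, a < 1 ∧ 0 < C ∧ ∀ (d H : ℕ) (γ : Fin 2 → ℂ), Admissible d H γ → IndexLE M γ →
    bound a b C d H ≤ ‖γ - theta‖

/-- `Semi M` — the crux restricted to the complementary SEMI-ENTANGLED population (some coordinate
sits in a subfield of `ℚ(γ)` of index `> M`). -/
def Semi (M : ℕ) : Prop :=
  ∃ a b C : ℝ, a < 1 ∧ 0 < C ∧ ∀ (d H : ℕ) (γ : Fin 2 → ℂ), Admissible d H γ → ¬ IndexLE M γ →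
    bound a b C d H ≤ ‖γ - theta‖

/-- Bookkeeping: the crux is the conjunction of its two halves (merge `(a, b, C)` by `max`,
monotonicity as in `Disproof.measureAt_mono`). -/
theorem crux_iff_core_and_semi (M : ℕ) : EPiSimultaneousType ↔ Core M ∧ Semi M := by
  sorry

/-- FIRST LEMMA (bookkeeping half): a primitive approximation measure at `θ` with exponent `p < 2`
gives `Core M` for EVERY `M`, with `a = p − 1` (at level `d ≥ r = [ℚ(γ):ℚ]`, both coordinate
degrees are `≥ r/M`, so `d'` may be taken `≥ r/M`; the level is normalised to `r` through minimal
polynomials at the price `log H ↦ log H + 3d`, tree `EPiSimultaneousType.clause_irreducible`). -/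
theorem core_of_primitiveApproxMeasure {p q C : ℝ} (hp1 : 1 ≤ p) (hp : p < 2) (hq : 0 ≤ q)
    (h : PrimitiveApproxMeasure 2 theta p q C) (M : ℕ) : Core M := by
  sorry

/-- FIRST LEMMA (the point): ANY decoupled codimension-one measure for `(π, e)` with total-degree
exponent `μ < 3` (linear in `log H`; Dirichlet floor `μ ≥ 2`) closes the bounded-index core for
every `M`, with `a = (μ − 1)/2`, through the PARENT line's stub `CodimOneTransfer`
(Siegel inside the ideal of the challenger, `p = (μ+1)/2`). No slot dichotomy, no `e`-floor. -/
theorem core_of_codimOneMeasure (hT : CodimOneTransfer) {μ K C : ℝ} (hμ2 : 2 ≤ μ) (hμ : μ < 3)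
    (hK : 0 ≤ K) (h : CodimOneMeasure 2 theta μ K C) (M : ℕ) : Core M := by
  sorry

/-! ## Why the route only needs `Core`: AP(1) approximants of a curve point are curve points -/

/-- ON-CURVE weak approximation property of level 1 at `ϑ` (all scales, output-dependent, no height
upper bound — the shape `Disproof.WeakAPAt ϑ 1` consumes — PLUS: the approximant lies on any given
`ℚ`-curve through `ϑ`). Laurent–Roy 1999 Thm 1 (Ann. Inst. Fourier 49, p. 29; proof §6 p. 41:
`α = φ(α₁)` is the LIFT along the curve of a degree-controlled approximant of one coordinate). -/
def WeakAPOneOnCurveAt (ϑ : Fin 2 → ℂ) : Prop :=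
  ∀ Q : MvPolynomial (Fin 2) ℤ, Q ≠ 0 → MvPolynomial.aeval ϑ Q = 0 →
    ∃ c : ℝ, 1 ≤ c ∧ ∀ Δ Y : ℝ, c ≤ Δ → Δ ≤ Y → ∃ (γ : Fin 2 → ℂ) (d H : ℕ),
      Admissible d H γ ∧ MvPolynomial.aeval γ Q = 0 ∧ (d : ℝ) ≤ c * Δ ∧
        ‖γ - ϑ‖ ≤ Real.exp (-((Real.log H * Δ + d * Y) / c))

/-- CURVE POINTS HAVE BOUNDED ENTANGLEMENT INDEX: if `Q ∈ ℤ[x, y]` is irreducible with both partial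
degrees positive and `Q(γ) = 0`, then `[ℚ(γ):ℚ(γ₁)] ≤ deg_y Q` and `[ℚ(γ):ℚ(γ₂)] ≤ deg_x Q`
(`γ₂` is a root of `Q(γ₁, y) ≢ 0`: the coefficients `qⱼ(x)` have no common root, else a common factor
in `ℚ[x]`, contradicting irreducibility). -/
theorem indexLE_of_onCurve (Q : MvPolynomial (Fin 2) ℤ) (hQ : Irreducible Q)
    (h0 : 0 < Q.degreeOf 0) (h1 : 0 < Q.degreeOf 1) (γ : Fin 2 → ℂ)
    (hγ : MvPolynomial.aeval γ Q = 0) : IndexLE Q.totalDegree γ := by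
  sorry

/-- THE CORE RACE: the on-curve level-1 property at `(π, e)` and the crux ON THE CORE ONLY already
give `e ⊥ π` (if `trdeg ℚ(π, e) ≤ 1`, take an irreducible `Q` with `Q(π, e) = 0`; its on-curve
approximants have index `≤ deg Q`; race as in `Disproof.race` with `t = 1` against `Core (deg Q)`). -/
theorem epiRace_core (hAP : WeakAPOneOnCurveAt theta) (hcore : ∀ M, Core M) :
    AlgebraicIndependent ℚ ![Real.exp 1, Real.pi] := by
  sorry

/-! ## The same in Philippon currency (route note; combines with RouteNoteIdeator3g2 §R2) -/

/-- `Core` in Philippon currency `u = log H + d log(d+1) + 1`, exponent `τ`. -/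
def CorePhilippon (M : ℕ) (τ : ℝ) : Prop :=
  ∃ C : ℝ, 0 < C ∧ ∀ (d H : ℕ) (γ : Fin 2 → ℂ), Admissible d H γ → IndexLE M γ →
    Real.exp (-(C * (Real.log H + d * Real.log ((d : ℝ) + 1) + 1) ^ τ)) ≤ ‖γ - theta‖

/-- A codimension-one measure in Philippon currency: `log|P(ω)| ≥ −C (deg P · (log H(P) + deg P))^τ`
(the OUTPUT SHAPE of criteria for algebraic independence; e.g. `τ = 4/3 + ε` is Nesterenko's for
`(π, e^π, Γ(1/4))`). Dirichlet forces `τ ≥ 3/2` for pairs. -/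
def CodimOnePhilippon (ω : Fin 2 → ℂ) (τ C : ℝ) : Prop :=
  0 < C ∧ ∀ P : MvPolynomial (Fin 2) ℤ, P ≠ 0 →
    Real.exp (-(C * ((max 1 (P.totalDegree : ℝ)) *
      (Real.log (max 1 (mvNatHeight P : ℝ)) + max 1 (P.totalDegree : ℝ))) ^ τ)) ≤
      ‖MvPolynomial.aeval ω P‖

/-- Transfer on the core in Philippon currency (same Siegel-in-the-ideal lever; on index `≤ M`
challengers `deg P · (h(P) + deg P) ≲ M^{3/2} log H + M r`). -/
theorem corePhilippon_of_codimOnePhilippon (hS : SiegelInIdeal) {τ C : ℝ} (hτ : 1 ≤ τ)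
    (h : CodimOnePhilippon theta τ C) (M : ℕ) : CorePhilippon M τ := by
  sorry

/-- The core race in Philippon currency: exponent `τ < 2` suffices (as in `epiRace_philippon` of
RouteNoteIdeator3g2, restricted to the core by `indexLE_of_onCurve`). -/
theorem epiRace_corePhilippon {τ : ℝ} (hτ : τ < 2) (hAP : WeakAPOneOnCurveAt theta)
    (hcore : ∀ M, CorePhilippon M τ) : AlgebraicIndependent ℚ ![Real.exp 1, Real.pi] := by
  sorry

/-! ## Where `Semi` lives: subfield lattice of the challenger field -/

/-- Tower law: each coordinate degree divides the field degree. -/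
theorem coordDeg_dvd_fieldDeg (γ : Fin 2 → ℂ) (halg : ∀ i, IsAlgebraic ℚ (γ i)) (i : Fin 2) :
    coordDeg γ i ∣ fieldDeg γ := by
  sorry

/-- PRIME LEVELS ARE PURE: if `[ℚ(γ):ℚ]` is prime, either both coordinates generate `ℚ(γ)` (index 1)
or some coordinate is rational. Hence the semi-entangled population needs a COMPOSITE field degree
with a divisor in the `e`-side window; at prime field degrees `Semi M` reduces to challengers with a
rational coordinate (killed by the finite irrationality measures of `π` and `e`). -/
theorem indexLE_one_or_ratCoord_of_prime (γ : Fin 2 → ℂ) (halg : ∀ i, IsAlgebraic ℚ (γ i))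
    (hp : (fieldDeg γ).Prime) : IndexLE 1 γ ∨ ∃ i, coordDeg γ i = 1 := by
  sorry

end Summit.Schanuel.Schanuel.Cruxes.EPiSimultaneousType.BoundedIndexCore

end
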